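import Mathlib
import Literature.Algebra.Polynomial.SelfReciprocalZerosCriterion
import HarnessLib

/-!
# Suzuki's determinant formula for self-reciprocal polynomials, genus `g = 2` (Suzuki 2018, §1 and §7.5)

A kernel-checked transcription, AS PRINTED and specialised to `g = 2`, of the objects of

> M. Suzuki, *An inverse problem for a class of canonical systems and its applications to
> self-reciprocal polynomials*, J. Anal. Math. 136 (2018) 273–340 = arXiv:1308.0228
> [Suzuki2018InverseProblem]: §1 — the lower-triangular Toeplitz matrices `E^±(C)` of size `2g+1`
> (first column `C_{∓g}, C_{∓(g−1)}, …, C_{±g}`), the corner antidiagonal matrices `J_n`, the quotients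
> (0423_7) `Δ_n = det(E⁺ + E⁻J_n)/det(E⁺ − E⁻J_n)` («`Δ_n = ∞` if `det(E⁺ − E⁻J_n) = 0`»), the numbers
> (0423_8) `δ_n(c) = Δ_n × (1 if n even, g log q if n odd)` with `C` obtained from the coefficients
> `c = (c₀, …, c_g)` of the self-reciprocal polynomial `P_g` by (0418_1)
> `Σ_m C_m T^m := Σ_{m=0}^{g} c_{g−m}(1 − log q^m)T^m + Σ_{m=1}^{g} c_{g−m}(1 + log q^m)T^{−m}`, and
> Theorem 1.4 (the vanishing of `det(E⁺ ± E⁻J_n)` and the values `δ_n(c)` do not depend on `q > 1`;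
> all roots of `P_g` are simple and on `T` iff `0 < δ_n(c) < ∞`, `1 ≤ n ≤ 2g`); §7.5 — the printed
> values `δ₂(P₂) = (4c₀+c₁)/(4c₀−c₁)`, `δ₃(P₂) = (8c₀²−2c₁²+4c₀c₂)/(8c₀²+c₁²−4c₀c₂)`,
> `δ₄(P₂) = (2c₀+2c₁+c₂)/(2c₀−2c₁+c₂)`, «`δ₁(P_g) = 1` in general», the size-`n` reduction
> `det(E⁺ ± E⁻J_n) = C_{−g}^{2g+1−n} det((E⁺ ± E⁻J_n)_{↖n})`, and the Schur–Cohn/Takagi determinants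
> `D_k(P₂′)` of Theorem 7.4 with the three displayed values.

What is here (all for `g = 2`, `L := log q` kept as a real parameter):
* `Eplus`, `Eminus` (the `5 × 5` matrices `E^±(C)` with `C₂ = c₀(1−2L)`, `C₁ = c₁(1−L)`, `C₀ = c₂`,
  `C₋₁ = c₁(1+L)`, `C₋₂ = c₀(1+2L)` substituted from (0418_1)), `Jmat n` (`J_n`), `Delta`, `delta`
  ((0423_7), (0423_8) with `g log q = 2L`).
* The eight determinants `det(E⁺ ± E⁻J_n)`, `n = 1, …, 4`, in closed form (`det_add_one` …
  `det_sub_four`) — each exhibits the printed reduction factor `C₋₂^{5−n}`.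
* §7.5 AS PRINTED: `delta_one` (`δ₁ = 1`), `delta_two`, `delta_three`, `delta_four` (the three
  displayed quotients), and Theorem 1.4's `q`-independence for `g = 2` (`delta_indep`).
* Theorem 7.4's matrices `D₁, D₂, D₃` for `Q = P₂′ = 4c₀x³ + 3c₁x² + 2c₂x + c₁`, built literally as
  displayed, with their determinants (`det_takagiD₁/₂/₃`). RECORD (as-printed sign): with the
  displayed `D_k`, `det D₁ = +(4c₀−c₁)(4c₀+c₁)` and `det D₃ = +16(2c₀+2c₁+c₂)(2c₀−2c₁+c₂)(8c₀²+c₁²−4c₀c₂)²`,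
  whereas the source prints these two right-hand sides for `−det D₁` and `−det D₃` (the even one,
  `det D₂ = 4(8c₀²−2c₁²+4c₀c₂)(8c₀²+c₁²−4c₀c₂)`, agrees); i.e. the displayed signs for odd `k` presume
  a different row convention for `D_k` (Takagi's) than the one displayed in Theorem 7.4. Informative
  only; the cell's STEP-0 of record (kit j240143) found the same discrepancy by exact arithmetic.

* **Theorem 1.4 (the criterion) for `g = 2` PROVED** (`onCircleSimple_iff_delta_pos`): for `c₀ ≠ 0`
  and `q > 1`, all roots of `P₂` are simple and on `T` iff `0 < δ_n(c)` for `n = 1, …, 4` — by the three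
  identities and Theorem 2.6 (`g = 2`) of Suzuki (2012), proved (elementarily, not by canonical
  systems) in `Literature.Algebra.Polynomial.SelfReciprocalZerosCriterion` (same quotients `R₂, R₃, R₄`).

Honesty. Only `g = 2` is typed (literal `5 × 5` matrices); the general-`g` objects, Theorem 1.1 (the
Hamiltonian `H(a)`, the canonical system, the class HB) and the proofs of §§2–6 are NOT here, and the
`g = 2` criterion is obtained by the elementary route of the companion file, not by the source's.

Purpose (cell `run/shared/lean/pub/rh-dbr`, COLUMN 6 DBR, LADDER-RH B-D instrument custody): this is
the kernel form of STEP-0 anchor **P3** and of «lineage B» (the determinant engine) for `g = 2` — in the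
kit STEP-0 of record the recursion engine (lineage A, arXiv:1211.2953) and this determinant engine agree
exactly on 1717 values; here the `g = 2` agreement `δ_n = R_n` is an identity checked by the kernel.
RH-FREE: finite identities between explicit polynomials; nothing here bears on the Riemann Hypothesis.

## References
* [Suzuki2018InverseProblem] M. Suzuki, J. Anal. Math. 136 (2018) 273–340 = arXiv:1308.0228: §1
  (0418_1), (0418_2), (0423_7), (0423_8), Theorems 1.1 and 1.4; §7.5 (Theorem 7.4 and the displays).
* [Suzuki2012SelfReciprocal] M. Suzuki, On zeros of self-reciprocal polynomials, arXiv:1211.2953: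
  §2.2 (the same quotients as `R₂, R₃, R₄`; not restated here).
-/

noncomputable section

namespace Literature.Algebra.Polynomial

namespace SuzukiSelfReciprocal

namespace GenusTwo

open Matrix

/-! ## The matrices `E^±`, `J_n` and the quotients `Δ_n`, `δ_n` for `g = 2` -/

/-- `E⁺(C)` for `g = 2`: the `5 × 5` lower-triangular Toeplitz matrix with first column
`(C₋₂, C₋₁, C₀, C₁, C₂) = (c₀(1+2L), c₁(1+L), c₂, c₁(1−L), c₀(1−2L))`, `L = log q`, the `C_m` taken
from the coefficients `c = (c₀, c₁, c₂)` of `P₂` by (0418_1).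
[cite: Suzuki2018InverseProblem, §1 (display of E^±) with (0418_1), g = 2] -/
def Eplus (c₀ c₁ c₂ L : ℝ) : Matrix (Fin 5) (Fin 5) ℝ :=
  !![c₀ * (1 + 2 * L), 0, 0, 0, 0;
     c₁ * (1 + L), c₀ * (1 + 2 * L), 0, 0, 0;
     c₂, c₁ * (1 + L), c₀ * (1 + 2 * L), 0, 0;
     c₁ * (1 - L), c₂, c₁ * (1 + L), c₀ * (1 + 2 * L), 0;
     c₀ * (1 - 2 * L), c₁ * (1 - L), c₂, c₁ * (1 + L), c₀ * (1 + 2 * L)]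

/-- `E⁻(C)` for `g = 2`: the `5 × 5` lower-triangular Toeplitz matrix with first column
`(C₂, C₁, C₀, C₋₁, C₋₂) = (c₀(1−2L), c₁(1−L), c₂, c₁(1+L), c₀(1+2L))`, `L = log q`.
[cite: Suzuki2018InverseProblem, §1 (display of E^±) with (0418_1), g = 2] -/
def Eminus (c₀ c₁ c₂ L : ℝ) : Matrix (Fin 5) (Fin 5) ℝ :=
  !![c₀ * (1 - 2 * L), 0, 0, 0, 0;
     c₁ * (1 - L), c₀ * (1 - 2 * L), 0, 0, 0;
     c₂, c₁ * (1 - L), c₀ * (1 - 2 * L), 0, 0;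
     c₁ * (1 + L), c₂, c₁ * (1 - L), c₀ * (1 - 2 * L), 0;
     c₀ * (1 + 2 * L), c₁ * (1 + L), c₂, c₁ * (1 - L), c₀ * (1 - 2 * L)]

/-- `J_n = J_n^{(5)}` (`1 ≤ n ≤ 4`): the antidiagonal unit matrix `J^{(n)}` of size `n` in the upper-left
corner of a `5 × 5` zero matrix. [cite: Suzuki2018InverseProblem, §1 (display of J_n), 2g+1 = 5] -/
def Jmat (n : ℕ) : Matrix (Fin 5) (Fin 5) ℝ :=
  Matrix.of fun i j => if (i : ℕ) < n ∧ (i : ℕ) + (j : ℕ) + 1 = n then 1 else 0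

/-- `J₁` written out. [cite: Suzuki2018InverseProblem, §1 (display of J_n), n = 1] -/
theorem Jmat_one : Jmat 1 =
    !![1, 0, 0, 0, 0; 0, 0, 0, 0, 0; 0, 0, 0, 0, 0; 0, 0, 0, 0, 0; 0, 0, 0, 0, 0] := by
  ext i j; fin_cases i <;> fin_cases j <;> simp [Jmat]

/-- `J₂` written out. [cite: Suzuki2018InverseProblem, §1 (display of J_n), n = 2] -/
theorem Jmat_two : Jmat 2 =
    !![0, 1, 0, 0, 0; 1, 0, 0, 0, 0; 0, 0, 0, 0, 0; 0, 0, 0, 0, 0; 0, 0, 0, 0, 0] := by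
  ext i j; fin_cases i <;> fin_cases j <;> simp [Jmat]

/-- `J₃` written out. [cite: Suzuki2018InverseProblem, §1 (display of J_n), n = 3] -/
theorem Jmat_three : Jmat 3 =
    !![0, 0, 1, 0, 0; 0, 1, 0, 0, 0; 1, 0, 0, 0, 0; 0, 0, 0, 0, 0; 0, 0, 0, 0, 0] := by
  ext i j; fin_cases i <;> fin_cases j <;> simp [Jmat]

/-- `J₄` written out. [cite: Suzuki2018InverseProblem, §1 (display of J_n), n = 4] -/
theorem Jmat_four : Jmat 4 =
    !![0, 0, 0, 1, 0; 0, 0, 1, 0, 0; 0, 1, 0, 0, 0; 1, 0, 0, 0, 0; 0, 0, 0, 0, 0] := by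
  ext i j; fin_cases i <;> fin_cases j <;> simp [Jmat]

/-- (0423_7) for `g = 2`: `Δ_n(C) = det(E⁺ + E⁻J_n) / det(E⁺ − E⁻J_n)` (`1 ≤ n ≤ 4`; the source's
«`Δ_n = ∞`» when the denominator vanishes is Lean's `x / 0 = 0` here — every use below carries the
non-vanishing explicitly or is insensitive to it). [cite: Suzuki2018InverseProblem, §1 (0423_7), g = 2] -/
def Delta (c₀ c₁ c₂ L : ℝ) (n : ℕ) : ℝ :=
  (Eplus c₀ c₁ c₂ L + Eminus c₀ c₁ c₂ L * Jmat n).det /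
    (Eplus c₀ c₁ c₂ L - Eminus c₀ c₁ c₂ L * Jmat n).det

/-- (0423_8) for `g = 2`: `δ_n(c) = Δ_n × (1 if n is even, g log q = 2L if n is odd)`.
[cite: Suzuki2018InverseProblem, §1 (0423_8), g = 2] -/
def delta (c₀ c₁ c₂ L : ℝ) (n : ℕ) : ℝ :=
  Delta c₀ c₁ c₂ L n * (if n % 2 = 1 then 2 * L else 1)

/-! ## The eight determinants `det(E⁺ ± E⁻ J_n)`, `n = 1, …, 4` -/

/-- `det(E⁺ + E⁻J_1) = 2c₀·C₋₂⁴` for `g = 2` (`C₋₂ = c₀(1+2L)`; the last factor is the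
size-`n` reduction `C_{−g}^{2g+1−n}` of §7.5, the rest the `1 × 1` corner determinant, evaluated).
[cite: Suzuki2018InverseProblem, §1 (0423_7) with (0418_1) and §7.5 (size-n reduction), g = 2, n = 1, evaluated here] -/
theorem det_add_one (c₀ c₁ c₂ L : ℝ) :
    (Eplus c₀ c₁ c₂ L + Eminus c₀ c₁ c₂ L * Jmat 1).det =
      2 * c₀ * (c₀ * (1 + 2 * L)) ^ 4 := by
  rw [Jmat_one]
  simp [Eplus, Eminus, Matrix.det_succ_row_zero, Fin.sum_univ_succ, Fin.succAbove]
  ring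

/-- `det(E⁺ - E⁻J_1) = 4c₀L·C₋₂⁴` for `g = 2` (`C₋₂ = c₀(1+2L)`; the last factor is the
size-`n` reduction `C_{−g}^{2g+1−n}` of §7.5, the rest the `1 × 1` corner determinant, evaluated).
[cite: Suzuki2018InverseProblem, §1 (0423_7) with (0418_1) and §7.5 (size-n reduction), g = 2, n = 1, evaluated here] -/
theorem det_sub_one (c₀ c₁ c₂ L : ℝ) :
    (Eplus c₀ c₁ c₂ L - Eminus c₀ c₁ c₂ L * Jmat 1).det =
      4 * c₀ * L * (c₀ * (1 + 2 * L)) ^ 4 := by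
  rw [Jmat_one]
  simp [Eplus, Eminus, Matrix.det_succ_row_zero, Fin.sum_univ_succ, Fin.succAbove]
  ring

/-- `det(E⁺ + E⁻J_2) = 2c₀L(4c₀+c₁)·C₋₂³` for `g = 2` (`C₋₂ = c₀(1+2L)`; the last factor is the
size-`n` reduction `C_{−g}^{2g+1−n}` of §7.5, the rest the `2 × 2` corner determinant, evaluated).
[cite: Suzuki2018InverseProblem, §1 (0423_7) with (0418_1) and §7.5 (size-n reduction), g = 2, n = 2, evaluated here] -/
theorem det_add_two (c₀ c₁ c₂ L : ℝ) :
    (Eplus c₀ c₁ c₂ L + Eminus c₀ c₁ c₂ L * Jmat 2).det =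
      2 * c₀ * L * (4 * c₀ + c₁) * (c₀ * (1 + 2 * L)) ^ 3 := by
  rw [Jmat_two]
  simp [Eplus, Eminus, Matrix.det_succ_row_zero, Fin.sum_univ_succ, Fin.succAbove]
  ring

/-- `det(E⁺ - E⁻J_2) = 2c₀L(4c₀−c₁)·C₋₂³` for `g = 2` (`C₋₂ = c₀(1+2L)`; the last factor is the
size-`n` reduction `C_{−g}^{2g+1−n}` of §7.5, the rest the `2 × 2` corner determinant, evaluated).
[cite: Suzuki2018InverseProblem, §1 (0423_7) with (0418_1) and §7.5 (size-n reduction), g = 2, n = 2, evaluated here] -/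
theorem det_sub_two (c₀ c₁ c₂ L : ℝ) :
    (Eplus c₀ c₁ c₂ L - Eminus c₀ c₁ c₂ L * Jmat 2).det =
      2 * c₀ * L * (4 * c₀ - c₁) * (c₀ * (1 + 2 * L)) ^ 3 := by
  rw [Jmat_two]
  simp [Eplus, Eminus, Matrix.det_succ_row_zero, Fin.sum_univ_succ, Fin.succAbove]
  ring

/-- `det(E⁺ + E⁻J_3) = 4c₀L(4c₀²+2c₀c₂−c₁²)·C₋₂²` for `g = 2` (`C₋₂ = c₀(1+2L)`; the last factor is the
size-`n` reduction `C_{−g}^{2g+1−n}` of §7.5, the rest the `3 × 3` corner determinant, evaluated).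
[cite: Suzuki2018InverseProblem, §1 (0423_7) with (0418_1) and §7.5 (size-n reduction), g = 2, n = 3, evaluated here] -/
theorem det_add_three (c₀ c₁ c₂ L : ℝ) :
    (Eplus c₀ c₁ c₂ L + Eminus c₀ c₁ c₂ L * Jmat 3).det =
      4 * c₀ * L * (4 * c₀ ^ 2 + 2 * c₀ * c₂ - c₁ ^ 2) * (c₀ * (1 + 2 * L)) ^ 2 := by
  rw [Jmat_three]
  simp [Eplus, Eminus, Matrix.det_succ_row_zero, Fin.sum_univ_succ, Fin.succAbove]
  ring

/-- `det(E⁺ - E⁻J_3) = 4c₀L²(8c₀²+c₁²−4c₀c₂)·C₋₂²` for `g = 2` (`C₋₂ = c₀(1+2L)`; the last factor is the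
size-`n` reduction `C_{−g}^{2g+1−n}` of §7.5, the rest the `3 × 3` corner determinant, evaluated).
[cite: Suzuki2018InverseProblem, §1 (0423_7) with (0418_1) and §7.5 (size-n reduction), g = 2, n = 3, evaluated here] -/
theorem det_sub_three (c₀ c₁ c₂ L : ℝ) :
    (Eplus c₀ c₁ c₂ L - Eminus c₀ c₁ c₂ L * Jmat 3).det =
      4 * c₀ * L ^ 2 * (8 * c₀ ^ 2 + c₁ ^ 2 - 4 * c₀ * c₂) * (c₀ * (1 + 2 * L)) ^ 2 := by
  rw [Jmat_three]
  simp [Eplus, Eminus, Matrix.det_succ_row_zero, Fin.sum_univ_succ, Fin.succAbove]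
  ring

/-- `det(E⁺ + E⁻J_4) = 4c₀L²(8c₀²+c₁²−4c₀c₂)(2c₀+2c₁+c₂)·C₋₂` for `g = 2` (`C₋₂ = c₀(1+2L)`; the last factor is the
size-`n` reduction `C_{−g}^{2g+1−n}` of §7.5, the rest the `4 × 4` corner determinant, evaluated).
[cite: Suzuki2018InverseProblem, §1 (0423_7) with (0418_1) and §7.5 (size-n reduction), g = 2, n = 4, evaluated here] -/
theorem det_add_four (c₀ c₁ c₂ L : ℝ) :
    (Eplus c₀ c₁ c₂ L + Eminus c₀ c₁ c₂ L * Jmat 4).det =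
      4 * c₀ * L ^ 2 * (8 * c₀ ^ 2 + c₁ ^ 2 - 4 * c₀ * c₂) * (2 * c₀ + 2 * c₁ + c₂) *
        (c₀ * (1 + 2 * L)) := by
  rw [Jmat_four]
  simp [Eplus, Eminus, Matrix.det_succ_row_zero, Fin.sum_univ_succ, Fin.succAbove]
  ring

/-- `det(E⁺ - E⁻J_4) = 4c₀L²(8c₀²+c₁²−4c₀c₂)(2c₀−2c₁+c₂)·C₋₂` for `g = 2` (`C₋₂ = c₀(1+2L)`; the last factor is the
size-`n` reduction `C_{−g}^{2g+1−n}` of §7.5, the rest the `4 × 4` corner determinant, evaluated).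
[cite: Suzuki2018InverseProblem, §1 (0423_7) with (0418_1) and §7.5 (size-n reduction), g = 2, n = 4, evaluated here] -/
theorem det_sub_four (c₀ c₁ c₂ L : ℝ) :
    (Eplus c₀ c₁ c₂ L - Eminus c₀ c₁ c₂ L * Jmat 4).det =
      4 * c₀ * L ^ 2 * (8 * c₀ ^ 2 + c₁ ^ 2 - 4 * c₀ * c₂) * (2 * c₀ - 2 * c₁ + c₂) *
        (c₀ * (1 + 2 * L)) := by
  rw [Jmat_four]
  simp [Eplus, Eminus, Matrix.det_succ_row_zero, Fin.sum_univ_succ, Fin.succAbove]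
  ring

/-! ## §7.5 as printed: `δ₁ = 1`, `δ₂, δ₃, δ₄`, and `q`-independence (Theorem 1.4, `g = 2`) -/

/-- The common non-vanishing factor: `c₀ ≠ 0`, `L > 0` ⟹ `c₀ · L^k · C₋₂^m ≠ 0`-type products.
[folklore] -/
private theorem base_ne_zero {c₀ L : ℝ} (h₀ : c₀ ≠ 0) (hL : 0 < L) (k m : ℕ) (r : ℝ) (hr : r ≠ 0) :
    r * c₀ * L ^ k * (c₀ * (1 + 2 * L)) ^ m ≠ 0 := by
  have h1 : (1 + 2 * L) ≠ 0 := by linarith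
  have hLne : L ≠ 0 := hL.ne'
  exact mul_ne_zero (mul_ne_zero (mul_ne_zero hr h₀) (pow_ne_zero _ hLne))
    (pow_ne_zero _ (mul_ne_zero h₀ h1))

/-- «`δ₁(P_g) = 1` in general», `g = 2`: for `c₀ ≠ 0` and `L = log q > 0`, `δ₁ = 2L · 2c₀C₋₂⁴/(4c₀L C₋₂⁴) = 1`.
[cite: Suzuki2018InverseProblem, §7.5 («δ₁(P_g) = 1 in general»), g = 2] -/
theorem delta_one {c₀ L : ℝ} (c₁ c₂ : ℝ) (h₀ : c₀ ≠ 0) (hL : 0 < L) : delta c₀ c₁ c₂ L 1 = 1 := by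
  have hK := base_ne_zero h₀ hL 1 4 4 (by norm_num)
  rw [delta, Delta, det_add_one, det_sub_one, if_pos (by norm_num), div_mul_eq_mul_div]
  rw [show 2 * c₀ * (c₀ * (1 + 2 * L)) ^ 4 * (2 * L) = 4 * c₀ * L ^ 1 * (c₀ * (1 + 2 * L)) ^ 4 by ring,
    show 4 * c₀ * L * (c₀ * (1 + 2 * L)) ^ 4 = 4 * c₀ * L ^ 1 * (c₀ * (1 + 2 * L)) ^ 4 by ring]
  exact div_self hK

/-- §7.5, `δ₂(P₂) = (4c₀ + c₁)/(4c₀ − c₁)` (for `c₀ ≠ 0`, `L = log q > 0`; both sides are `0` in Lean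
when `4c₀ = c₁`, the source's `δ₂ = ∞`). [cite: Suzuki2018InverseProblem, §7.5 (display of δ₂(P₂))] -/
theorem delta_two {c₀ L : ℝ} (c₁ c₂ : ℝ) (h₀ : c₀ ≠ 0) (hL : 0 < L) :
    delta c₀ c₁ c₂ L 2 = (4 * c₀ + c₁) / (4 * c₀ - c₁) := by
  have hK := base_ne_zero h₀ hL 1 3 2 (by norm_num)
  rw [delta, Delta, det_add_two, det_sub_two, if_neg (by norm_num), mul_one]
  rw [show 2 * c₀ * L * (4 * c₀ + c₁) * (c₀ * (1 + 2 * L)) ^ 3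
        = (4 * c₀ + c₁) * (2 * c₀ * L ^ 1 * (c₀ * (1 + 2 * L)) ^ 3) by ring,
    show 2 * c₀ * L * (4 * c₀ - c₁) * (c₀ * (1 + 2 * L)) ^ 3
        = (4 * c₀ - c₁) * (2 * c₀ * L ^ 1 * (c₀ * (1 + 2 * L)) ^ 3) by ring]
  exact mul_div_mul_right _ _ hK

/-- §7.5, `δ₃(P₂) = (8c₀² − 2c₁² + 4c₀c₂)/(8c₀² + c₁² − 4c₀c₂)` (for `c₀ ≠ 0`, `L = log q > 0`; the
odd-`n` factor `g log q = 2L` cancels the extra `L` of the denominator determinant).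
[cite: Suzuki2018InverseProblem, §7.5 (display of δ₃(P₂))] -/
theorem delta_three {c₀ L : ℝ} (c₁ c₂ : ℝ) (h₀ : c₀ ≠ 0) (hL : 0 < L) :
    delta c₀ c₁ c₂ L 3 = (8 * c₀ ^ 2 - 2 * c₁ ^ 2 + 4 * c₀ * c₂) / (8 * c₀ ^ 2 + c₁ ^ 2 - 4 * c₀ * c₂) := by
  have hK := base_ne_zero h₀ hL 2 2 4 (by norm_num)
  rw [delta, Delta, det_add_three, det_sub_three, if_pos (by norm_num), div_mul_eq_mul_div]
  rw [show 4 * c₀ * L * (4 * c₀ ^ 2 + 2 * c₀ * c₂ - c₁ ^ 2) * (c₀ * (1 + 2 * L)) ^ 2 * (2 * L)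
        = (8 * c₀ ^ 2 - 2 * c₁ ^ 2 + 4 * c₀ * c₂) * (4 * c₀ * L ^ 2 * (c₀ * (1 + 2 * L)) ^ 2) by ring,
    show 4 * c₀ * L ^ 2 * (8 * c₀ ^ 2 + c₁ ^ 2 - 4 * c₀ * c₂) * (c₀ * (1 + 2 * L)) ^ 2
        = (8 * c₀ ^ 2 + c₁ ^ 2 - 4 * c₀ * c₂) * (4 * c₀ * L ^ 2 * (c₀ * (1 + 2 * L)) ^ 2) by ring]
  exact mul_div_mul_right _ _ hK

/-- §7.5, `δ₄(P₂) = (2c₀ + 2c₁ + c₂)/(2c₀ − 2c₁ + c₂)` — for `c₀ ≠ 0`, `L = log q > 0` AND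
`8c₀² + c₁² − 4c₀c₂ ≠ 0`: this discriminant divides BOTH `det(E⁺ ± E⁻J₄)`, so when it vanishes the
source's `Δ₄` is `∞` (`0/0`, i.e. `0` in Lean) while the printed quotient need not be; the identity is
one of rational functions, stated off that divisor. [cite: Suzuki2018InverseProblem, §7.5 (display of δ₄(P₂))] -/
theorem delta_four {c₀ c₁ c₂ L : ℝ} (h₀ : c₀ ≠ 0) (hL : 0 < L)
    (hD : 8 * c₀ ^ 2 + c₁ ^ 2 - 4 * c₀ * c₂ ≠ 0) :
    delta c₀ c₁ c₂ L 4 = (2 * c₀ + 2 * c₁ + c₂) / (2 * c₀ - 2 * c₁ + c₂) := by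
  have hK := base_ne_zero h₀ hL 2 1 (4 * (8 * c₀ ^ 2 + c₁ ^ 2 - 4 * c₀ * c₂))
    (mul_ne_zero (by norm_num) hD)
  rw [delta, Delta, det_add_four, det_sub_four, if_neg (by norm_num), mul_one]
  rw [show 4 * c₀ * L ^ 2 * (8 * c₀ ^ 2 + c₁ ^ 2 - 4 * c₀ * c₂) * (2 * c₀ + 2 * c₁ + c₂) *
        (c₀ * (1 + 2 * L)) = (2 * c₀ + 2 * c₁ + c₂) *
        (4 * (8 * c₀ ^ 2 + c₁ ^ 2 - 4 * c₀ * c₂) * c₀ * L ^ 2 * (c₀ * (1 + 2 * L)) ^ 1) by ring,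
    show 4 * c₀ * L ^ 2 * (8 * c₀ ^ 2 + c₁ ^ 2 - 4 * c₀ * c₂) * (2 * c₀ - 2 * c₁ + c₂) *
        (c₀ * (1 + 2 * L)) = (2 * c₀ - 2 * c₁ + c₂) *
        (4 * (8 * c₀ ^ 2 + c₁ ^ 2 - 4 * c₀ * c₂) * c₀ * L ^ 2 * (c₀ * (1 + 2 * L)) ^ 1) by ring]
  exact mul_div_mul_right _ _ hK

/-- **Theorem 1.4, first assertion, for `g = 2`**: the numbers `δ_n(c)` (`1 ≤ n ≤ 4`) do not depend on
`q > 1` — for any two `L = log q > 0`, `L' = log q' > 0` they coincide (including the degenerate cases,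
where both are Lean's `0`). [cite: Suzuki2018InverseProblem, Thm 1.4 (q-independence), g = 2] -/
theorem delta_indep {c₀ L L' : ℝ} (c₁ c₂ : ℝ) (h₀ : c₀ ≠ 0) (hL : 0 < L) (hL' : 0 < L') {n : ℕ}
    (hn : 1 ≤ n ∧ n ≤ 4) : delta c₀ c₁ c₂ L n = delta c₀ c₁ c₂ L' n := by
  obtain ⟨h1, h4⟩ := hn
  interval_cases n
  · rw [delta_one c₁ c₂ h₀ hL, delta_one c₁ c₂ h₀ hL']
  · rw [delta_two c₁ c₂ h₀ hL, delta_two c₁ c₂ h₀ hL']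
  · rw [delta_three c₁ c₂ h₀ hL, delta_three c₁ c₂ h₀ hL']
  · by_cases hD : 8 * c₀ ^ 2 + c₁ ^ 2 - 4 * c₀ * c₂ = 0
    · -- both denominators vanish: `δ₄ = 0/0 = 0` on either side
      rw [delta, delta, Delta, Delta, det_sub_four, det_sub_four, hD]
      simp
    · rw [delta_four h₀ hL hD, delta_four h₀ hL' hD]

/-- `A·K = 0 ↔ A·K' = 0` when `K, K' ≠ 0`. [folklore] -/
private theorem factor_zero_iff {A K K' : ℝ} (hK : K ≠ 0) (hK' : K' ≠ 0) :
    A * K = 0 ↔ A * K' = 0 := by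
  constructor
  · intro h
    rcases mul_eq_zero.mp h with h | h
    · exact mul_eq_zero.mpr (Or.inl h)
    · exact absurd h hK
  · intro h
    rcases mul_eq_zero.mp h with h | h
    · exact mul_eq_zero.mpr (Or.inl h)
    · exact absurd h hK'

/-- **Theorem 1.4, first assertion (vanishing), for `g = 2`**: whether `det(E⁺ − E⁻J_n)` vanishes does
not depend on `q > 1`. [cite: Suzuki2018InverseProblem, Thm 1.4 (q-independence of the vanishing), g = 2] -/
theorem det_sub_eq_zero_indep {c₀ L L' : ℝ} (c₁ c₂ : ℝ) (h₀ : c₀ ≠ 0) (hL : 0 < L) (hL' : 0 < L')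
    {n : ℕ} (hn : 1 ≤ n ∧ n ≤ 4) :
    (Eplus c₀ c₁ c₂ L - Eminus c₀ c₁ c₂ L * Jmat n).det = 0 ↔
      (Eplus c₀ c₁ c₂ L' - Eminus c₀ c₁ c₂ L' * Jmat n).det = 0 := by
  have hA := base_ne_zero h₀ hL 1 4 4 (by norm_num)
  have hA' := base_ne_zero h₀ hL' 1 4 4 (by norm_num)
  have hB := base_ne_zero h₀ hL 1 3 2 (by norm_num)
  have hB' := base_ne_zero h₀ hL' 1 3 2 (by norm_num)
  have hC := base_ne_zero h₀ hL 2 2 4 (by norm_num)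
  have hC' := base_ne_zero h₀ hL' 2 2 4 (by norm_num)
  have hE := base_ne_zero h₀ hL 2 1 4 (by norm_num)
  have hE' := base_ne_zero h₀ hL' 2 1 4 (by norm_num)
  obtain ⟨h1, h4⟩ := hn
  interval_cases n
  · rw [det_sub_one, det_sub_one]
    rw [show 4 * c₀ * L * (c₀ * (1 + 2 * L)) ^ 4 = 4 * c₀ * L ^ 1 * (c₀ * (1 + 2 * L)) ^ 4 by ring,
      show 4 * c₀ * L' * (c₀ * (1 + 2 * L')) ^ 4 = 4 * c₀ * L' ^ 1 * (c₀ * (1 + 2 * L')) ^ 4 by ring]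
    exact ⟨fun h => absurd h hA, fun h => absurd h hA'⟩
  · rw [det_sub_two, det_sub_two]
    rw [show 2 * c₀ * L * (4 * c₀ - c₁) * (c₀ * (1 + 2 * L)) ^ 3
          = (4 * c₀ - c₁) * (2 * c₀ * L ^ 1 * (c₀ * (1 + 2 * L)) ^ 3) by ring,
      show 2 * c₀ * L' * (4 * c₀ - c₁) * (c₀ * (1 + 2 * L')) ^ 3
          = (4 * c₀ - c₁) * (2 * c₀ * L' ^ 1 * (c₀ * (1 + 2 * L')) ^ 3) by ring]
    exact factor_zero_iff hB hB'
  · rw [det_sub_three, det_sub_three]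
    rw [show 4 * c₀ * L ^ 2 * (8 * c₀ ^ 2 + c₁ ^ 2 - 4 * c₀ * c₂) * (c₀ * (1 + 2 * L)) ^ 2
          = (8 * c₀ ^ 2 + c₁ ^ 2 - 4 * c₀ * c₂) * (4 * c₀ * L ^ 2 * (c₀ * (1 + 2 * L)) ^ 2) by ring,
      show 4 * c₀ * L' ^ 2 * (8 * c₀ ^ 2 + c₁ ^ 2 - 4 * c₀ * c₂) * (c₀ * (1 + 2 * L')) ^ 2
          = (8 * c₀ ^ 2 + c₁ ^ 2 - 4 * c₀ * c₂) * (4 * c₀ * L' ^ 2 * (c₀ * (1 + 2 * L')) ^ 2) by ring]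
    exact factor_zero_iff hC hC'
  · rw [det_sub_four, det_sub_four]
    rw [show 4 * c₀ * L ^ 2 * (8 * c₀ ^ 2 + c₁ ^ 2 - 4 * c₀ * c₂) * (2 * c₀ - 2 * c₁ + c₂) *
          (c₀ * (1 + 2 * L)) = ((8 * c₀ ^ 2 + c₁ ^ 2 - 4 * c₀ * c₂) * (2 * c₀ - 2 * c₁ + c₂)) *
          (4 * c₀ * L ^ 2 * (c₀ * (1 + 2 * L)) ^ 1) by ring,
      show 4 * c₀ * L' ^ 2 * (8 * c₀ ^ 2 + c₁ ^ 2 - 4 * c₀ * c₂) * (2 * c₀ - 2 * c₁ + c₂) *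
          (c₀ * (1 + 2 * L')) = ((8 * c₀ ^ 2 + c₁ ^ 2 - 4 * c₀ * c₂) * (2 * c₀ - 2 * c₁ + c₂)) *
          (4 * c₀ * L' ^ 2 * (c₀ * (1 + 2 * L')) ^ 1) by ring]
    exact factor_zero_iff hE hE'

/-- **Theorem 1.4 (the criterion), `g = 2`.** For real `c₀ ≠ 0`, `c₁`, `c₂` and `q > 1`
(`L = log q > 0`): all roots of `P₂(x) = c₀(x⁴+1) + c₁(x³+x) + c₂x²` are simple roots on `T`
⟺ `0 < δ_n(c) < ∞` for every `1 ≤ n ≤ 4` (in Lean `0 < δ_n`, finiteness being automatic). Proof: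
`δ₁ = 1`, `δ₂ = R₂`, `δ₃ = R₃`, and `δ₄ = R₄` off the divisor `8c₀² + c₁² − 4c₀c₂ = 0` — on which both
sides fail (`R₃ = δ₃ = 0` there) — then Theorem 2.6 (`g = 2`) of the companion file.
[cite: Suzuki2018InverseProblem, Thm 1.4 (criterion), g = 2; proof here via Suzuki 2012 Thm 2.6] -/
theorem onCircleSimple_iff_delta_pos {c₀ L : ℝ} (c₁ c₂ : ℝ) (h₀ : c₀ ≠ 0) (hL : 0 < L) :
    OnCircleSimple (P c₀ c₁ c₂) ↔ ∀ n : ℕ, 1 ≤ n → n ≤ 4 → 0 < delta c₀ c₁ c₂ L n := by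
  rw [onCircleSimple_iff c₁ c₂ h₀]
  have e2 : delta c₀ c₁ c₂ L 2 = R₂ c₀ c₁ c₂ := by rw [delta_two c₁ c₂ h₀ hL, R₂]
  have e3 : delta c₀ c₁ c₂ L 3 = R₃ c₀ c₁ c₂ := by rw [delta_three c₁ c₂ h₀ hL, R₃]
  have hD_of : 0 < R₃ c₀ c₁ c₂ → 8 * c₀ ^ 2 + c₁ ^ 2 - 4 * c₀ * c₂ ≠ 0 := by
    intro h3 hD
    have : R₃ c₀ c₁ c₂ = 0 := by rw [R₃, hD, div_zero]
    rw [this] at h3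
    exact lt_irrefl _ h3
  constructor
  · rintro ⟨h2, h3, h4⟩
    have e4 : delta c₀ c₁ c₂ L 4 = R₄ c₀ c₁ c₂ := by rw [delta_four h₀ hL (hD_of h3), R₄]
    intro n hn1 hn4
    interval_cases n
    · rw [delta_one c₁ c₂ h₀ hL]; exact one_pos
    · rwa [e2]
    · rwa [e3]
    · rwa [e4]
  · intro h
    have h2 := h 2 (by norm_num) (by norm_num)
    have h3 := h 3 (by norm_num) (by norm_num)
    have h4 := h 4 (by norm_num) (by norm_num)
    rw [e2] at h2
    rw [e3] at h3
    rw [delta_four h₀ hL (hD_of h3), ← R₄] at h4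
    exact ⟨h2, h3, h4⟩

/-! ## §7.5, Theorem 7.4: the Schur–Cohn/Takagi determinants of `P₂′` -/

/-- `D₁(Q) = [[a₀, a₃], [ā₃, ā₀]]` for `Q = P₂′(x) = 4c₀x³ + 3c₁x² + 2c₂x + c₁` (real coefficients,
so the bars are vacuous): `[[4c₀, c₁], [c₁, 4c₀]]`. [cite: Suzuki2018InverseProblem, Thm 7.4 (display of D₁), Q = P₂′] -/
def takagiD₁ (c₀ c₁ : ℝ) : Matrix (Fin 2) (Fin 2) ℝ := !![4 * c₀, c₁; c₁, 4 * c₀]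

/-- `D₂(Q)` as displayed in Theorem 7.4, for `Q = P₂′` (`a₀ = 4c₀, a₁ = 3c₁, a₂ = 2c₂, a₃ = c₁`):
rows `(a₀, a₁ | a₃, 0)`, `(0, a₀ | a₂, a₃)`, `(ā₃, ā₂ | ā₀, 0)`, `(0, ā₃ | ā₁, ā₀)`.
[cite: Suzuki2018InverseProblem, Thm 7.4 (display of D₂), Q = P₂′] -/
def takagiD₂ (c₀ c₁ c₂ : ℝ) : Matrix (Fin 4) (Fin 4) ℝ :=
  !![4 * c₀, 3 * c₁, c₁, 0;
     0, 4 * c₀, 2 * c₂, c₁;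
     c₁, 2 * c₂, 4 * c₀, 0;
     0, c₁, 3 * c₁, 4 * c₀]

/-- `D₃(Q) = D_n(Q)` (`n = 3`) as displayed in Theorem 7.4 — the resultant matrix of `Q` and `Q♯` —
for `Q = P₂′`: rows `(a₀,a₁,a₂,a₃,0,0)`, `(0,a₀,a₁,a₂,a₃,0)`, `(0,0,a₀,a₁,a₂,a₃)`, `(ā₃,ā₂,ā₁,ā₀,0,0)`,
`(0,ā₃,ā₂,ā₁,ā₀,0)`, `(0,0,ā₃,ā₂,ā₁,ā₀)`. [cite: Suzuki2018InverseProblem, Thm 7.4 (display of D_n), Q = P₂′] -/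
def takagiD₃ (c₀ c₁ c₂ : ℝ) : Matrix (Fin 6) (Fin 6) ℝ :=
  !![4 * c₀, 3 * c₁, 2 * c₂, c₁, 0, 0;
     0, 4 * c₀, 3 * c₁, 2 * c₂, c₁, 0;
     0, 0, 4 * c₀, 3 * c₁, 2 * c₂, c₁;
     c₁, 2 * c₂, 3 * c₁, 4 * c₀, 0, 0;
     0, c₁, 2 * c₂, 3 * c₁, 4 * c₀, 0;
     0, 0, c₁, 2 * c₂, 3 * c₁, 4 * c₀]

/-- `det D₁(P₂′) = (4c₀ − c₁)(4c₀ + c₁)` for `D₁` as displayed. AS-PRINTED RECORD: the source displays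
this right-hand side for `−det D₁(P₂′)`; with the displayed `D₁ = [[a₀, a_n],[ā_n, ā₀]]` the sign is `+`
(`det = |a₀|² − |a_n|²`). [cite: Suzuki2018InverseProblem, §7.5 (display «−det D₁(P₂′) = (4c₀ − c₁)(4c₀ + c₁)», sign as recorded)] -/
theorem det_takagiD₁ (c₀ c₁ : ℝ) : (takagiD₁ c₀ c₁).det = (4 * c₀ - c₁) * (4 * c₀ + c₁) := by
  rw [takagiD₁, Matrix.det_fin_two_of]
  ring

/-- `det D₂(P₂′) = 4(8c₀² − 2c₁² + 4c₀c₂)(8c₀² + c₁² − 4c₀c₂)`, exactly as printed.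
[cite: Suzuki2018InverseProblem, §7.5 (display «det D₂(P₂′) = 4(8c₀²−2c₁²+4c₀c₂)(8c₀²+c₁²−4c₀c₂)»)] -/
theorem det_takagiD₂ (c₀ c₁ c₂ : ℝ) :
    (takagiD₂ c₀ c₁ c₂).det =
      4 * (8 * c₀ ^ 2 - 2 * c₁ ^ 2 + 4 * c₀ * c₂) * (8 * c₀ ^ 2 + c₁ ^ 2 - 4 * c₀ * c₂) := by
  simp [takagiD₂, Matrix.det_succ_row_zero, Fin.sum_univ_succ, Fin.succAbove]
  ring

/-- `det D₃(P₂′) = 16(2c₀ + 2c₁ + c₂)(2c₀ − 2c₁ + c₂)(8c₀² + c₁² − 4c₀c₂)²` for `D₃` as displayed.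
AS-PRINTED RECORD: the source displays this right-hand side for `−det D₃(P₂′)`; with `D₃` built
literally from Theorem 7.4's display the sign is `+` (as for `D₁`; the even case `D₂` agrees as
printed). [cite: Suzuki2018InverseProblem, §7.5 (display «−det D₃(P₂′) = 16(…)(…)(…)²», sign as recorded)] -/
theorem det_takagiD₃ (c₀ c₁ c₂ : ℝ) :
    (takagiD₃ c₀ c₁ c₂).det =
      16 * (2 * c₀ + 2 * c₁ + c₂) * (2 * c₀ - 2 * c₁ + c₂) *
        (8 * c₀ ^ 2 + c₁ ^ 2 - 4 * c₀ * c₂) ^ 2 := by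
  simp [takagiD₃, Matrix.det_succ_row_zero, Fin.sum_univ_succ, Fin.succAbove]
  ring

end GenusTwo

end SuzukiSelfReciprocal

end Literature.Algebra.Polynomial
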